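import Literature.Analysis.FluidPDE.MikadoScales
import Literature.Analysis.FluidPDE.LacunaryScaleSums
import Mathlib.Analysis.Complex.ExponentialBounds
import HarnessLib

/-!
# Cheskidov–Dai–Palasek 2025, §3.1: the frequency scales as the tree's integer lacunary scales,
# and the scale hypotheses of `h₃`

Sixth sibling proof file (all results proved; no definitions, no named facts) of the barrier entry
`Literature/Barriers/NavierStokesRegularity/InstantaneousTypeIBlowup` (A. Cheskidov, M. Dai,
S. Palasek, arXiv:2511.09556 (2025), Thm. 1.1). §3.1 fixes the frequency scales
`N_{j,k} = ⌈A^{b^k}⌉` (`d ≥ 3`) resp. `⌈A^{b^{k+(j-1)/J_d}}⌉` (`d = 2`, `J_2 = 3`) and the interceding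
scales `M_{j,k} = ⌈A^{γ b^k}⌉` resp. `⌈A^{γ b^{k+(j-1)/J_d}}⌉`, with "`b > 1`, which can be safely
assigned as `b = 3`", `γ ∈ (0,1)` with `γ > b^{-1/J_d}`, and "`A` … as large as needed". The
hypotheses `h₃` of `construction_of_blockBounds` and of `exists_lowerBound_seq_of_blocks` ask of
the (increasingly enumerated) scales only: positivity, `N_{k+1} ≥ 2N_k`, the double-exponential
growth `N_k ≥ exp(exp(κ(k+1)))`, and `N_{k+1}/N_k → ∞`.

An admissible INTEGER choice makes all ceilings disappear and identifies the scales with the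
tree's Coiculescu–Palasek scales `CP25.scaleM a b k = a^{b^k}`, `CP25.scaleN a b k = a^{2b^k}`
(`MikadoScales`): in `d ≥ 3` take `A = a²`, `b = 3`, `γ = 1/2` (`> b⁻¹`), so `N_k = a^{2·3^k} =
scaleN a 3 k`, `M_k = a^{3^k} = scaleM a 3 k`; in `d = 2` take `A = a²`, `b = 27`, `γ = 1/2`
(`> 27^{-1/3} = 1/3`), so that `b^{k+(j-1)/3} = 3^{3k+j-1}` and the scales enumerated by
`m = 3k + (j-1)` are again `N_m = a^{2·3^m} = scaleN a 3 m`, `M_m = scaleM a 3 m`. This file proves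
the four scale hypotheses for `N_k = scaleN a 3 k`, `a ≥ 8`:

* `scaleN_hyp_pos`, `scaleN_hyp_lacunary` (`2N_k ≤ N_{k+1}`, from `CP25.two_mul_scaleN_le_succ`);
* `exp_exp_le_scaleN` — `exp(exp(log 3 · (k+1))) ≤ N_k`, i.e. `3^{k+1} ≤ log N_k = 2·3^k log a`
  (`log a ≥ 2 ≥ 3/2` for `a ≥ 8 > e²`);
* `tendsto_scaleN_ratio_atTop` — `N_{k+1}/N_k = N_k² → ∞`;
* `scaleN_hypotheses` — the package, with `κ = log 3`.

## References

* A. Cheskidov, M. Dai, S. Palasek, arXiv:2511.09556 (2025), §3.1 (the scales and the standing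
  largeness assumptions on `A`). [`CheskidovDaiPalasek2025`]
* M. P. Coiculescu, S. Palasek, Invent. Math. 244 (2025), §2.4 (the tree's `MikadoScales`).
  [`CoiculescuPalasek2025`]
-/

noncomputable section

open Filter Topology

namespace Literature.Barriers.NavierStokesRegularity

open Literature.Analysis.FluidPDE

variable {a : ℕ}

/-- `0 < N_k` (as a real number). [cite: CheskidovDaiPalasek2025, §3.1] -/
theorem scaleN_hyp_pos (ha : 1 ≤ a) (k : ℕ) : (0 : ℝ) < (CP25.scaleN a 3 k : ℝ) := by
  exact_mod_cast CP25.scaleN_pos ha 3 k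

/-- `2 N_k ≤ N_{k+1}` (as real numbers), `a ≥ 2`. [cite: CheskidovDaiPalasek2025, §3.1] -/
theorem scaleN_hyp_lacunary (ha : 2 ≤ a) (k : ℕ) :
    2 * (CP25.scaleN a 3 k : ℝ) ≤ (CP25.scaleN a 3 (k + 1) : ℝ) := by
  exact_mod_cast CP25.two_mul_scaleN_le_succ ha (by norm_num) k

/-- `N_k = a^{2·3^k}` as a real number. [cite: CheskidovDaiPalasek2025, §3.1] -/
theorem cast_scaleN_three (a k : ℕ) : (CP25.scaleN a 3 k : ℝ) = (a : ℝ) ^ (2 * 3 ^ k) := by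
  simp only [CP25.scaleN, CP25.scaleM, Nat.cast_pow]
  rw [← pow_mul, mul_comm]

/-- **Double-exponential growth**: `exp(exp(log 3 · (k+1))) ≤ N_k` for `a ≥ 8`, i.e.
`3^{k+1} ≤ log N_k = 2 · 3^k · log a`. [cite: CheskidovDaiPalasek2025, §3.1] -/
theorem exp_exp_le_scaleN (ha : 8 ≤ a) (k : ℕ) :
    Real.exp (Real.exp (Real.log 3 * ((k : ℝ) + 1))) ≤ (CP25.scaleN a 3 k : ℝ) := by
  have ha' : (8 : ℝ) ≤ a := by exact_mod_cast ha
  have ha0 : (0 : ℝ) < a := by linarith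
  -- `2 ≤ log a` for `a ≥ 8 > e²` (`e < 2.7182818286`; cf. the tree's
  -- `Literature.NumberTheory.LFunctions.two_le_log_of_eight_le`, not imported here)
  have hlog : 2 ≤ Real.log a := by
    have h := Real.exp_one_lt_d9
    have h0 : 0 < Real.exp 1 := Real.exp_pos 1
    have h2 : Real.exp 2 = Real.exp 1 * Real.exp 1 := by rw [← Real.exp_add]; norm_num
    rw [Real.le_log_iff_exp_le ha0, h2]
    nlinarith
  have hN0 : (0 : ℝ) < (CP25.scaleN a 3 k : ℝ) := scaleN_hyp_pos (by omega) k
  rw [← Real.le_log_iff_exp_le hN0, cast_scaleN_three, Real.log_pow]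
  have h3 : Real.exp (Real.log 3 * ((k : ℝ) + 1)) = 3 ^ (k + 1) := by
    rw [← Real.rpow_def_of_pos (by norm_num : (0 : ℝ) < 3), ← Real.rpow_natCast]
    push_cast
    ring_nf
  rw [h3]
  push_cast
  have h4 : (0 : ℝ) ≤ 3 ^ k := by positivity
  calc (3 : ℝ) ^ (k + 1) = 3 ^ k * 3 := pow_succ _ _
    _ ≤ 3 ^ k * (2 * Real.log a) := by gcongr; linarith
    _ = 2 * 3 ^ k * Real.log a := by ring

/-- **Super-lacunarity**: `N_{k+1}/N_k = N_k² → ∞` (`a ≥ 2`). [cite: CheskidovDaiPalasek2025, §3.1] -/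
theorem tendsto_scaleN_ratio_atTop (ha : 2 ≤ a) :
    Tendsto (fun k => (CP25.scaleN a 3 (k + 1) : ℝ) / (CP25.scaleN a 3 k : ℝ)) atTop atTop := by
  have ha1 : 1 ≤ a := by omega
  have heq : ∀ k, (CP25.scaleN a 3 (k + 1) : ℝ) / (CP25.scaleN a 3 k : ℝ) =
      (CP25.scaleN a 3 k : ℝ) ^ 2 := by
    intro k
    have h0 : (CP25.scaleN a 3 k : ℝ) ≠ 0 := (scaleN_hyp_pos ha1 k).ne'
    rw [CP25.scaleN_succ]
    push_cast
    field_simp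
  simp_rw [heq]
  refine (tendsto_pow_atTop two_ne_zero).comp ?_
  -- `N_k → ∞`: `N_k ≥ 2^k N_0`
  have hgrow : ∀ k, (2 : ℝ) ^ k * (CP25.scaleN a 3 0 : ℝ) ≤ (CP25.scaleN a 3 k : ℝ) :=
    fun k => by
      have h := pow_mul_le_of_lacunary (N := fun k => (CP25.scaleN a 3 k : ℝ))
        (by norm_num : (0 : ℝ) ≤ 2) (fun k => scaleN_hyp_lacunary ha k) 0 k
      rwa [zero_add] at h
  refine tendsto_atTop_mono hgrow ?_
  exact (tendsto_pow_atTop_atTop_of_one_lt one_lt_two).atTop_mul_const (scaleN_hyp_pos ha1 0)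

/-- **The scale hypotheses of `h₃` for the integer scales `N_k = a^{2·3^k}`, `a ≥ 8`**: positivity,
`N_{k+1} ≥ 2N_k`, `N_k ≥ exp(exp(κ(k+1)))` with `κ = log 3 > 0`, and `N_{k+1}/N_k → ∞` — the inputs
of `construction_of_blockBounds` and `exists_lowerBound_seq_of_blocks` about the scales, for the
admissible choice `A = a²`, `b = 3` (`d ≥ 3`) resp. `b = 27` with the enumeration `m = 3k + j - 1`
(`d = 2`), `γ = 1/2`, of the parameters of §3.1. [cite: CheskidovDaiPalasek2025, §3.1] -/
theorem scaleN_hypotheses (ha : 8 ≤ a) :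
    (∀ k, (0 : ℝ) < (CP25.scaleN a 3 k : ℝ)) ∧
    (∀ k, 2 * (CP25.scaleN a 3 k : ℝ) ≤ (CP25.scaleN a 3 (k + 1) : ℝ)) ∧
    0 < Real.log 3 ∧
    (∀ k : ℕ, Real.exp (Real.exp (Real.log 3 * ((k : ℝ) + 1))) ≤ (CP25.scaleN a 3 k : ℝ)) ∧
    Tendsto (fun k => (CP25.scaleN a 3 (k + 1) : ℝ) / (CP25.scaleN a 3 k : ℝ)) atTop atTop :=
  ⟨fun k => scaleN_hyp_pos (by omega) k, fun k => scaleN_hyp_lacunary (by omega) k,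
    Real.log_pos (by norm_num), exp_exp_le_scaleN ha, tendsto_scaleN_ratio_atTop (by omega)⟩

end Literature.Barriers.NavierStokesRegularity
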